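import Literature.Analysis.FluidPDE.TypeIAncientMild
import Literature.Analysis.FluidPDE.SwirlTransportProofs
import HarnessLib

/-!
# `ScarRigidity`, line `SketchIdeator6`: stub S3b `stub_rotationOrbitIncrement`

The rotation orbit `θ ↦ R_θ V(t, R_{−θ} x)` of a smooth (Type-I ancient mild) profile `V` is
Lipschitz at `V` in the scale-invariant weighted sup-norm with weight
`w(t,x) = (−t)/(‖x‖+√(−t))³`, with Lipschitz constant the weighted bound `K` of the rotation
generator `J V − ∇V·(J x)` (`J = rotGen = (d/dθ) R_θ|₀`).

Proof: for fixed `t < 0`, `x`, the curve `Φ(θ) = R_θ V(t, R_{−θ} x)` has velocity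
`Φ'(θ) = R_θ [J V − ∇V·(J·)](t, R_{−θ} x)`; rotations preserve norms and the weight, so
`‖Φ'‖ ≤ K w(t,x)` and the mean value inequality on `[0, θ]` gives the claim (`Φ(0) = V(t,x)`).
-/

noncomputable section

open Set Filter Function

set_option linter.dupNamespace false -- D-0017: `Summit.<S>.<S>.…` repeats the summit name by design

namespace Summit.NavierStokesRegularity.NavierStokesRegularity.Theorems.RellichScarScarRigidity

open Literature.Analysis.FluidPDE

/-- Physical space. -/
local notation "ℝ³" => EuclideanSpace ℝ (Fin 3)

/-- The reversed rotation orbit `ψ ↦ R_{−ψ} x` has velocity `−J (R_{−φ} x)` at `ψ = φ`. -/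
private theorem hasDerivAt_rotZ_neg_orbit (x : ℝ³) (φ : ℝ) :
    HasDerivAt (fun ψ : ℝ => rotZ (-ψ) x) (-rotGen (rotZ (-φ) x)) φ := by
  refine ((hasDerivAt_rotZ x (-φ)).scomp φ (hasDerivAt_neg φ)).congr_deriv ?_
  ext i
  fin_cases i <;> simp [rotGen, Real.sin_neg, Real.cos_neg]

/-- **Velocity of a rotated curve.** If `a : ℝ → ℝ³` has velocity `a'` at `φ`, then
`ψ ↦ R_ψ (a ψ)` has velocity `R_φ (a' + J (a φ))` at `φ` (Rodrigues form
`R_ψ v = v + sin ψ • J v + (1 − cos ψ) • J (J v)` and the product rule). -/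
private theorem hasDerivAt_rotZ_curve {a : ℝ → ℝ³} {a' : ℝ³} {φ : ℝ} (ha : HasDerivAt a a' φ) :
    HasDerivAt (fun ψ : ℝ => rotZ ψ (a ψ)) (rotZ φ (a' + rotGen (a φ))) φ := by
  -- Rodrigues form of the rotation through its generator
  have hrod : ∀ (ψ : ℝ) (v : ℝ³),
      rotZ ψ v = v + Real.sin ψ • rotGen v + (1 - Real.cos ψ) • rotGen (rotGen v) := by
    intro ψ v
    ext i
    fin_cases i <;> simp [rotZ, rotGen] <;> ring
  have hJ : HasDerivAt (fun ψ : ℝ => rotGen (a ψ)) (rotGen a') φ := by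
    have h := rotGenL.hasFDerivAt.comp_hasDerivAt φ ha
    simpa only [Function.comp_def, rotGenL_apply] using h
  have hJJ : HasDerivAt (fun ψ : ℝ => rotGen (rotGen (a ψ))) (rotGen (rotGen a')) φ := by
    have h := rotGenL.hasFDerivAt.comp_hasDerivAt φ hJ
    simpa only [Function.comp_def, rotGenL_apply] using h
  have hsin : HasDerivAt (fun ψ : ℝ => Real.sin ψ) (Real.cos φ) φ := Real.hasDerivAt_sin φ
  have hcos : HasDerivAt (fun ψ : ℝ => 1 - Real.cos ψ) (-(-Real.sin φ)) φ :=
    (Real.hasDerivAt_cos φ).const_sub 1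
  have hsum := (ha.add (hsin.smul hJ)).add (hcos.smul hJJ)
  have e : (fun ψ : ℝ => rotZ ψ (a ψ)) = fun ψ : ℝ =>
      a ψ + Real.sin ψ • rotGen (a ψ) + (1 - Real.cos ψ) • rotGen (rotGen (a ψ)) :=
    funext fun ψ => hrod ψ (a ψ)
  rw [e]
  refine hsum.congr_deriv ?_
  rw [hrod φ (a' + rotGen (a φ))]
  ext i
  fin_cases i <;> simp [rotGen] <;> ring

/-- **STUB S3b: the rotation orbit is Lipschitz at the profile in the weighted norm.**
`(d/dθ) R_θ V(t, R_{−θ}x) = R_θ [J V − ∇V·(J·)](t, R_{−θ}x)`, rotations preserve the weight, so the flat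
rotation generator integrates to `‖R_θ V(t,R_{−θ}x) − V(t,x)‖ ≤ K|θ|(−t)/(‖x‖+√(−t))³`. -/
theorem stub_rotationOrbitIncrement :
    ∀ (V : ℝ → ℝ³ → ℝ³) (C K : ℝ), IsTypeIAncientMild C V →
      (∀ t < 0, ∀ x : ℝ³,
        ‖rotGen (V t x) - fderiv ℝ (V t) x (rotGen x)‖ ≤ K * ((-t) / (‖x‖ + Real.sqrt (-t)) ^ 3)) →
      ∀ (θ t : ℝ), t < 0 → ∀ x : ℝ³,
        ‖rotZ θ (V t (rotZ (-θ) x)) - V t x‖ ≤ K * |θ| * ((-t) / (‖x‖ + Real.sqrt (-t)) ^ 3) := by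
  intro V C K hmild hgen θ t ht x
  have hdiff : Differentiable ℝ (V t) := (hmild.contDiff_slice ht).differentiable (by simp)
  -- velocity of the orbit `Φ ψ = R_ψ V(t, R_{−ψ} x)` at every angle
  have hΦ : ∀ φ : ℝ, HasDerivAt (fun ψ : ℝ => rotZ ψ (V t (rotZ (-ψ) x)))
      (rotZ φ (fderiv ℝ (V t) (rotZ (-φ) x) (-rotGen (rotZ (-φ) x)) +
        rotGen (V t (rotZ (-φ) x)))) φ := fun φ =>
    hasDerivAt_rotZ_curve ((hdiff _).hasFDerivAt.comp_hasDerivAt φ (hasDerivAt_rotZ_neg_orbit x φ))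
  -- its norm is the generator at the rotated point, and the weight is rotation invariant
  have hbound : ∀ φ : ℝ, ‖rotZ φ (fderiv ℝ (V t) (rotZ (-φ) x) (-rotGen (rotZ (-φ) x)) +
      rotGen (V t (rotZ (-φ) x)))‖ ≤ K * ((-t) / (‖x‖ + Real.sqrt (-t)) ^ 3) := by
    intro φ
    have h := hgen t ht (rotZ (-φ) x)
    rw [norm_rotZ] at h
    rw [norm_rotZ, map_neg, neg_add_eq_sub]
    exact h
  -- mean value inequality on the line
  have hmvt := convex_univ.norm_image_sub_le_of_norm_hasDerivWithin_le
    (fun φ _ => (hΦ φ).hasDerivWithinAt) (fun φ _ => hbound φ) (mem_univ 0) (mem_univ θ)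
  simp only [neg_zero, rotZ_zero, sub_zero, Real.norm_eq_abs] at hmvt
  exact hmvt.trans (le_of_eq (by ring))

end Summit.NavierStokesRegularity.NavierStokesRegularity.Theorems.RellichScarScarRigidity
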